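import Summits.SmoothPoincare4.SmoothPoincare4.Theorems.SullivanDualTargetOfSympcap
import Literature.Geometry.Symplectic.GromovR4StdModel
import Mathlib.Analysis.SpecialFunctions.SmoothTransition
import Mathlib.Analysis.InnerProductSpace.Calculus
import Mathlib.Analysis.Calculus.Deriv.Slope
import Mathlib.Analysis.SpecialFunctions.ExpDeriv

/-!
# SmoothPoincare4 / SullivanDual — crux `Target` (stmt-SmoothPoincare4-7823), line kaehler-jacket,
# helper `helper_radialModel`: the radial star-shaped model as a global immersion

For a smooth function `u : ℝ⁴ → ℝ` (only its values on the unit sphere matter) the star-shaped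
hypersurface `Y = {e^{u(θ)/2} θ : θ ∈ S³}` is the image of `S³` under the RADIAL MODEL
`M y = e^{u(y/‖y‖)/2} y`, a ray-preserving diffeomorphism of `ℝ⁴ ∖ 0` which is not smooth at
the origin.  We prove `helper_radialModel`: there is a GLOBAL smooth map `M₀ : ℝ⁴ → ℝ⁴` with
everywhere injective differential which agrees with `M` on `{‖y‖ ≥ 1/2}`.

Construction.  Let `c` be a lower bound of `u` on the unit sphere (compactness), let
`φ y = smoothTransition (16/3 · (‖y‖² - 1/16))` — a smooth, radially monotone cut-off with
`φ = 0` on `{‖y‖ ≤ 1/4}` and `φ = 1` on `{‖y‖ ≥ 1/2}` — and put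
`ρ y = exp ((φ y · (u (y/‖y‖) - c) + c) / 2)`, `M₀ y = ρ y • y`.
* On `{‖y‖ ≥ 1/2}`: `φ = 1`, so `M₀ = M`.
* Smoothness: away from `0` every ingredient is smooth (`y ↦ ‖y‖⁻¹` is smooth off `0`); on the
  open ball `{‖y‖ < 1/4}` the cut-off vanishes and `M₀ = exp (c/2) • id` is linear.
* Immersion: `D(M₀)_y v = ρ y • v + (Dρ_y v) • y`, and a linear map `r • id + ℓ ⊗ y` with
  `r ≠ 0` is injective as soon as `r + ℓ y ≠ 0` (apply `ℓ` to `r • v + ℓ v • y = 0`).  Here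
  `r = ρ y > 0` and `ℓ y = Dρ_y y ≥ 0` is the RADIAL derivative of `ρ`, nonnegative because
  `t ↦ ρ (eᵗ • y)` is monotone — the direction `y/‖y‖` is dilation invariant, the cut-off is
  radially monotone and `u (y/‖y‖) - c ≥ 0` — and a monotone function has nonnegative derivative
  (`HasDerivAt.nonneg_of_monotone`).

Everything here is elementary calculus on `ℝ⁴`, stated without auxiliary definitions (the
cut-off is produced by an existence lemma, the other lemmas are about explicit expressions); no
manifold API is used.  The statement is folklore (star-shaped hypersurfaces as radial graphs).
-/

noncomputable section

-- the registered namespace `Summit.SmoothPoincare4.SmoothPoincare4.Theorems` repeats a component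
set_option linter.dupNamespace false

open scoped Manifold ContDiff Topology
open Set Function
open Literature.Geometry.Kaehler (MForm IsSmoothForm IsClosedForm mextDeriv)
open Literature.Geometry.Symplectic (punctured InPuncturedChartBall stdSymplecticForm inversion
  invertedStdForm IsSymplecticStandardNearPoint AgreesWithInvertedChartNear)
open Literature.Topology.FourManifolds (HomotopySphere)

namespace Summit.SmoothPoincare4.SmoothPoincare4.Theorems.Target.KaehlerJacket

local notation "E4" => EuclideanSpace ℝ (Fin 4)

namespace RadialModel

/-! ### Generic tools: a radial cut-off, the direction map, radial derivatives, linear algebra -/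

/-- A smooth, radially monotone cut-off on `ℝ⁴` which vanishes on the closed ball of radius
`1/4` and equals `1` off the open ball of radius `1/2`; namely
`φ y = smoothTransition (16/3 · (‖y‖² - 1/16))`. [folklore] -/
theorem exists_cutoff :
    ∃ φ : E4 → ℝ, ContDiff ℝ ∞ φ ∧ (∀ y : E4, ‖y‖ ≤ 1 / 4 → φ y = 0) ∧
      (∀ y : E4, 1 / 2 ≤ ‖y‖ → φ y = 1) ∧
      ∀ (y : E4) (s t : ℝ), 0 ≤ s → s ≤ t → φ (s • y) ≤ φ (t • y) := by
  refine ⟨fun y => Real.smoothTransition (16 / 3 * (‖y‖ ^ 2 - 1 / 16)), ?_, ?_, ?_, ?_⟩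
  · exact Real.smoothTransition.contDiff.comp
      (contDiff_const.mul ((contDiff_norm_sq ℝ).sub contDiff_const))
  · intro y hy
    exact Real.smoothTransition.zero_of_nonpos (by nlinarith [norm_nonneg y])
  · intro y hy
    exact Real.smoothTransition.one_of_one_le (by nlinarith)
  · intro y s t hs hst
    refine Real.smoothTransition.monotone ?_
    have h : ‖s • y‖ ^ 2 ≤ ‖t • y‖ ^ 2 := by
      rw [norm_smul, norm_smul, Real.norm_of_nonneg hs, Real.norm_of_nonneg (hs.trans hst)]
      exact pow_le_pow_left₀ (mul_nonneg hs (norm_nonneg y))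
        (mul_le_mul_of_nonneg_right hst (norm_nonneg y)) 2
    linarith

/-- The direction `‖y‖⁻¹ • y` is invariant under positive dilations. [folklore] -/
theorem dir_smul {t : ℝ} (ht : 0 < t) (y : E4) : ‖t • y‖⁻¹ • (t • y) = ‖y‖⁻¹ • y := by
  rw [norm_smul, Real.norm_of_nonneg ht.le, smul_smul, mul_inv_rev,
    inv_mul_cancel_right₀ ht.ne']

/-- The direction of a nonzero vector is a unit vector. [folklore] -/
theorem norm_dir {y : E4} (hy : y ≠ 0) : ‖‖y‖⁻¹ • y‖ = 1 := by
  rw [norm_smul, norm_inv, norm_norm, inv_mul_cancel₀ (norm_ne_zero_iff.2 hy)]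

/-- The direction map is smooth away from the origin. [folklore] -/
theorem contDiffAt_dir {y : E4} (hy : y ≠ 0) :
    ContDiffAt ℝ ∞ (fun z : E4 => ‖z‖⁻¹ • z) y :=
  ((contDiffAt_norm ℝ hy).fun_inv (norm_ne_zero_iff.2 hy)).fun_smul contDiffAt_id

/-- If a real function `ρ` on `ℝ⁴`, differentiable at `y`, is monotone along the ray through `y`
(parametrised exponentially, `t ↦ ρ (eᵗ • y)`), then its radial derivative `Dρ_y y` is
nonnegative. [folklore] -/
theorem fderiv_apply_self_nonneg_of_monotone {ρ : E4 → ℝ} {y : E4} (hρ : DifferentiableAt ℝ ρ y)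
    (hmono : Monotone fun t : ℝ => ρ (Real.exp t • y)) : 0 ≤ fderiv ℝ ρ y y := by
  have hγ : HasDerivAt (fun t : ℝ => Real.exp t • y) y 0 := by
    simpa using (Real.hasDerivAt_exp 0).smul_const y
  have hcomp : HasDerivAt (ρ ∘ fun t : ℝ => Real.exp t • y) (fderiv ℝ ρ y y) 0 :=
    hρ.hasFDerivAt.comp_hasDerivAt_of_eq 0 hγ (by simp)
  exact hcomp.nonneg_of_monotone hmono

/-- Linear algebra: a rank-one perturbation `r • id + ℓ ⊗ y` of a nonzero homothety is
injective as soon as `r + ℓ y ≠ 0` (apply `ℓ` to `r • v + ℓ v • y = 0`). [folklore] -/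
theorem injective_smul_id_add_smulRight {r : ℝ} {ℓ : E4 →L[ℝ] ℝ} {y : E4} (hr : r ≠ 0)
    (h : r + ℓ y ≠ 0) : Injective (r • ContinuousLinearMap.id ℝ E4 + ℓ.smulRight y) := by
  refine (injective_iff_map_eq_zero _).2 fun v hv => ?_
  have hv' : r • v + ℓ v • y = 0 := by simpa using hv
  have h1 : r * ℓ v + ℓ v * ℓ y = 0 := by simpa using congrArg ℓ hv'
  have h2 : ℓ v * (r + ℓ y) = 0 := by linear_combination h1
  have hℓ : ℓ v = 0 := (mul_eq_zero.1 h2).resolve_right h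
  rw [hℓ, zero_smul, add_zero] at hv'
  exact (smul_eq_zero.1 hv').resolve_left hr

/-- A map of the form `z ↦ ρ z • z` with `ρ` differentiable at `y`, `ρ y > 0` and nonnegative
radial derivative `Dρ_y y ≥ 0` has injective differential at `y`:
`D_y v = ρ y • v + (Dρ_y v) • y`. [folklore] -/
theorem injective_fderiv_smul_self {ρ : E4 → ℝ} {y : E4} (hρ : DifferentiableAt ℝ ρ y)
    (hpos : 0 < ρ y) (hrad : 0 ≤ fderiv ℝ ρ y y) :
    Injective (fderiv ℝ (fun z : E4 => ρ z • z) y) := by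
  have hd : HasFDerivAt (fun z : E4 => ρ z • z)
      (ρ y • ContinuousLinearMap.id ℝ E4 + (fderiv ℝ ρ y).smulRight y) y :=
    hρ.hasFDerivAt.fun_smul (hasFDerivAt_id y)
  rw [hd.fderiv]
  exact injective_smul_id_add_smulRight hpos.ne' (add_pos_of_pos_of_nonneg hpos hrad).ne'

/-- A map which agrees near `y` with a nonzero homothety `z ↦ r • z` is smooth at `y` with
injective differential there. [folklore] -/
theorem contDiffAt_and_injective_of_eventuallyEq {F : E4 → E4} {r : ℝ} {y : E4} (hr : r ≠ 0)
    (h : F =ᶠ[𝓝 y] fun z => r • z) : ContDiffAt ℝ ∞ F y ∧ Injective (fderiv ℝ F y) := by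
  refine ⟨(contDiff_const_smul r).contDiffAt.congr_of_eventuallyEq h, ?_⟩
  have hd : HasFDerivAt (fun z : E4 => r • z) (r • ContinuousLinearMap.id ℝ E4) y :=
    (hasFDerivAt_id y).fun_const_smul r
  rw [h.fderiv_eq, hd.fderiv]
  intro v w hvw
  have h' : r • v = r • w := by
    simpa only [smul_apply, ContinuousLinearMap.id_apply] using hvw
  exact smul_right_injective E4 hr h'

/-- A continuous function is bounded below on the unit sphere of `ℝ⁴` (compactness). [folklore] -/
theorem exists_lower_bound_sphere (u : E4 → ℝ) (hu : Continuous u) :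
    ∃ c : ℝ, ∀ θ : E4, ‖θ‖ = 1 → c ≤ u θ := by
  obtain ⟨c, hc⟩ := (isCompact_sphere (0 : E4) 1).bddBelow_image hu.continuousOn
  exact ⟨c, fun θ hθ => hc (mem_image_of_mem u (mem_sphere_zero_iff_norm.2 hθ))⟩

/-! ### The density `ρ y = exp ((φ y · (u (y/‖y‖) - c) + c) / 2)` -/

/-- The density is smooth away from the origin. [folklore] -/
theorem contDiffAt_density {u φ : E4 → ℝ} (hu : ContDiff ℝ ∞ u) (hφ : ContDiff ℝ ∞ φ) (c : ℝ)
    {y : E4} (hy : y ≠ 0) :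
    ContDiffAt ℝ ∞ (fun z : E4 => Real.exp ((φ z * (u (‖z‖⁻¹ • z) - c) + c) / 2)) y := by
  have h1 : ContDiffAt ℝ ∞ (fun z : E4 => u (‖z‖⁻¹ • z)) y :=
    hu.contDiffAt.comp y (contDiffAt_dir hy)
  exact Real.contDiff_exp.contDiffAt.comp y
    (((hφ.contDiffAt.mul (h1.sub contDiffAt_const)).add contDiffAt_const).div_const 2)

/-- Along each ray from the origin (parametrised exponentially) the density is monotone, provided
`c` is a lower bound of `u` on the unit sphere and the cut-off `φ` is radially monotone.
[folklore] -/
theorem monotone_density_ray {u φ : E4 → ℝ} {c : ℝ} (hc : ∀ θ : E4, ‖θ‖ = 1 → c ≤ u θ)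
    (hφm : ∀ (y : E4) (s t : ℝ), 0 ≤ s → s ≤ t → φ (s • y) ≤ φ (t • y)) {y : E4} (hy : y ≠ 0) :
    Monotone fun t : ℝ =>
      Real.exp ((φ (Real.exp t • y) * (u (‖Real.exp t • y‖⁻¹ • (Real.exp t • y)) - c) + c) / 2) := by
  intro s t hst
  dsimp only
  rw [dir_smul (Real.exp_pos s), dir_smul (Real.exp_pos t)]
  have h0 : 0 ≤ u (‖y‖⁻¹ • y) - c := sub_nonneg.2 (hc _ (norm_dir hy))
  have h1 : φ (Real.exp s • y) ≤ φ (Real.exp t • y) :=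
    hφm y _ _ (Real.exp_pos s).le (Real.exp_le_exp.2 hst)
  have h2 := mul_le_mul_of_nonneg_right h1 h0
  exact Real.exp_le_exp.2 (by linarith)

/-- Near every point of the open ball of radius `1/4` the model `z ↦ ρ z • z` is the homothety
`exp (c/2) • id`, provided the cut-off `φ` vanishes on the closed ball of radius `1/4`.
[folklore] -/
theorem model_eventuallyEq {u φ : E4 → ℝ} {c : ℝ} (hφ0 : ∀ y : E4, ‖y‖ ≤ 1 / 4 → φ y = 0)
    {y : E4} (hy : ‖y‖ < 1 / 4) :
    (fun z : E4 => Real.exp ((φ z * (u (‖z‖⁻¹ • z) - c) + c) / 2) • z) =ᶠ[𝓝 y]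
      fun z => Real.exp (c / 2) • z := by
  have hopen : IsOpen {z : E4 | ‖z‖ < 1 / 4} := isOpen_lt continuous_norm continuous_const
  filter_upwards [hopen.mem_nhds hy] with z hz
  have hz' : ‖z‖ < 1 / 4 := hz
  rw [hφ0 z hz'.le, zero_mul, zero_add]

end RadialModel

open RadialModel in
/-- **Helper B (the radial star-shaped model made a global immersion).** For every smooth
`u : ℝ⁴ → ℝ` there is a smooth map `M₀ : ℝ⁴ → ℝ⁴` with everywhere injective differential which
coincides with the radial model `y ↦ e^{u(y/‖y‖)/2} y` on `{‖y‖ ≥ 1/2}`.  Construction: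
`M₀ y = exp ((φ y · (u (y/‖y‖) - c) + c) / 2) • y` with `c` a lower bound of `u` on the unit
sphere and `φ` a radially monotone smooth cut-off (`0` on `{‖y‖ ≤ 1/4}`, `1` on `{‖y‖ ≥ 1/2}`);
see the module docstring. [folklore] -/
theorem helper_radialModel :
    ∀ (u : E4 → ℝ), ContDiff ℝ ∞ u →
      ∃ M₀ : E4 → E4, ContDiff ℝ ∞ M₀ ∧ (∀ y : E4, Injective (fderiv ℝ M₀ y)) ∧
        ∀ y : E4, 1 / 2 ≤ ‖y‖ → M₀ y = Real.exp (u (‖y‖⁻¹ • y) / 2) • y := by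
  intro u hu
  obtain ⟨c, hc⟩ := exists_lower_bound_sphere u hu.continuous
  obtain ⟨φ, hφs, hφ0, hφ1, hφm⟩ := exists_cutoff
  set ρ : E4 → ℝ := fun z => Real.exp ((φ z * (u (‖z‖⁻¹ • z) - c) + c) / 2) with hρdef
  have hρd : ∀ y : E4, y ≠ 0 → ContDiffAt ℝ ∞ ρ y := fun y hy => contDiffAt_density hu hφs c hy
  have hnear : ∀ y : E4, ‖y‖ < 1 / 4 → (fun z => ρ z • z) =ᶠ[𝓝 y] fun z => Real.exp (c / 2) • z :=
    fun y hy => model_eventuallyEq (u := u) (c := c) hφ0 hy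
  have h0 : ‖(0 : E4)‖ < 1 / 4 := by norm_num
  refine ⟨fun z => ρ z • z, ?_, ?_, ?_⟩
  · refine contDiff_iff_contDiffAt.2 fun y => ?_
    rcases eq_or_ne y 0 with rfl | hy
    · exact (contDiffAt_and_injective_of_eventuallyEq (Real.exp_pos _).ne' (hnear 0 h0)).1
    · exact (hρd y hy).fun_smul contDiffAt_id
  · intro y
    rcases eq_or_ne y 0 with rfl | hy
    · exact (contDiffAt_and_injective_of_eventuallyEq (Real.exp_pos _).ne' (hnear 0 h0)).2
    · have hdiff : DifferentiableAt ℝ ρ y := (hρd y hy).differentiableAt (by simp)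
      exact injective_fderiv_smul_self hdiff (Real.exp_pos _)
        (fderiv_apply_self_nonneg_of_monotone hdiff (monotone_density_ray hc hφm hy))
  · intro y hy
    simp only [hρdef, hφ1 y hy, one_mul, sub_add_cancel]

end Summit.SmoothPoincare4.SmoothPoincare4.Theorems.Target.KaehlerJacket

end
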